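import Summits.ResolutionOfSingularities.ResolutionOfSingularities.Theorems.EquisingularLiftEquisingularLiftNatHSUBeOfSuppliers
import Summits.ResolutionOfSingularities.ResolutionOfSingularities.Theorems.EquisingularLiftEquisingularLiftNatHostedSubchainPointResolutionE
import HarnessLib

/-!
# EL♮(3), nose doors: THE NOSE ROUND ON A GIVEN UPSTAIRS MODEL, DOOR-FREE (PHASE 2 of ✓ `hsube_of_suppliers` as a standalone lemma),
# and its INITIAL-STAGE instance «a regular `O`-flat model `𝓦 ⊂ ℙ³_O` of the nose `Z` with reduced trace ⇒ the new upstairs stage after the nose round and the B‴ tail»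

res-L1-w45b-nose-w1 g6 (WIDTH seat D-0157 DOOR 1; author of ✓ `hsube_of_suppliers` p676659 and of N-0 ✓ `jinit_rPlus₀` p694373).
WIDTH TABLE D9 «ν3-DIRECT» (desk RULING R71): the direct planar door blows the nose `Z = V₊(ℓ) ∩ V₊(g)` up AT THE INITIAL STAGE, with no inner
motive; upstairs its debt is «✓ `hsube_of_suppliers` with PHASE 1 deleted and HEND replaced by the explicit smoothing» (NU7-NOSE-SIZING v1.2 §A2,
res-L1-w45b-idea-2).  This module supplies the DOOR-INDEPENDENT part of that debt once and for all, so that the direct rung (res-L1-w45b-stub-4)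
only has to unpack the door text (res-type-027) and call res-L1-w45b-stub-2's smoothing `planar_trace_smoothing`:

* `noseRound_stage_of_model` — PHASE 2 STANDALONE, stage-generic and door-free: at ANY downstairs stage `(F₂, T₂)` carrying an infinite curve
  `Z₂ ⊆ T₂`, `T₂ ⊄ Z₂`, an upstairs stage `(X', σ', S', j, t)` in the chain TOGETHER WITH a regular `O`-flat model `C` of `Z₂` with reduced trace
  `C.comap j = 𝓘⟨Z₂⟩` (the HEND block of ✓ `hsube_of_suppliers`, VERBATIM), the nose blow-up `υ' : F₃ ⟶ F₂` of `𝓘⟨Z₂⟩` and a B‴ tail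
  (door clause VERBATIM) yield the new upstairs stage in HSUBʰ's currency with the host dropped (`LetterDatum … ∅`).  Proof = ✓ `hsube_of_suppliers`
  ll. 124–149 (E1-legality …NatCentreOffGeneric, `exists_isBlowup`, `modelStep_chain`, nose engine‴ `hsub_reachNoseTowerBTriplePrime_of_fact'`
  fed with (T-k), `TCPlus.letterDatum_empty`).  No map `F₂ ⟶ ℙ³_k` is needed.
* `hendBlock_stage_zero_of_model` — the HEND block AT THE INITIAL STAGE `(ℙ³_k, 𝟙, range ι, V₊(ℓ), Z)` from a given ideal sheaf `𝓦` on `ℙ³_O`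
  with `V(𝓦)` regular, `V(𝓦) → Spec O` flat and `𝓦.comap (Proj φ) = 𝓘⟨Z⟩` (= the three conjuncts res-L1-w45b-stub-2's `planar_trace_smoothing`
  delivers, SIG e3c9ce86dd96b53d): the stage is `(ℙ³_O, 𝟙, Y, Proj φ, t)` with the BASE MODEL SQUARE `ProjectiveAmbientFibre.isPullback_projMap`
  and dominance exactly as N-0 Level A ✓ `jinit_rPlus₀_of_noseDatum` / the K5ᵉ engine ✓ p674976 discharge them.
* `directNose_stage_zero_of_model` — the two composed: the upstairs debt of ONE direct planar nose move at the initial stage, MODULO the door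
  unpacking and the smoothing `𝓦` (both supplied by name by the rung).

Conditional on (T-k) = `EmbeddedCurveLiftFact` through the B‴ tail exactly like ✓ `hsube_of_suppliers` / (R-ν3) / (R-ν4).  DEF-FREE; no `sorry`;
standard axioms; no new mathematics (pure re-composition of landed modules); `--supports stmt-ResolutionOfSingularities-20148 --as helper`, counted 0.
EL♮(3) is NOT proved here; resolution of singularities in positive characteristic is NOT proved anywhere in this tree (dim 3 in print:
Cossart–Piltant 2008/2009); nothing of [Hironaka2017] is asserted.
-/

set_option linter.dupNamespace false -- mandated namespace `Summit.<Summit>.<Problem>` of this single-conjunct summit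
set_option linter.overlappingInstances false -- signatures carry `[IsDomain O] [IsDiscreteValuationRing O]`

noncomputable section

open CategoryTheory CategoryTheory.Limits AlgebraicGeometry TopologicalSpace Topology IsLocalRing
open MvPolynomial
open Literature.AlgebraicGeometry.Resolution
open AlgebraicGeometry.Scheme.IdealSheafData
open Summit.ResolutionOfSingularities.ResolutionOfSingularities.Theses.EquisingularLift.Split
open Summit.ResolutionOfSingularities.ResolutionOfSingularities.Cruxes.EquisingularLift.StrataSplit

namespace Summit.ResolutionOfSingularities.ResolutionOfSingularities.Cruxes.EquisingularLiftNat.Sections.Equinodal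

/-- **PHASE 2 STANDALONE (door-free, stage-generic): the nose round on a GIVEN regular `O`-flat upstairs model with reduced trace, then the B‴ tail.**
At a downstairs stage `(F₂, T₂)` with an infinite curve `Z₂ ⊆ T₂`, `T₂ ⊄ Z₂`: an upstairs stage in the chain WITH a model `C` of `Z₂`
(`V(C)` regular, `O`-flat, `C.comap j = 𝓘⟨Z₂⟩` — the HEND block of ✓ `hsube_of_suppliers` verbatim), the blow-up `υ'` of `𝓘⟨Z₂⟩` and a B‴ tail
(door clause verbatim) give the new upstairs stage `(X₉, σ₉, S₉, j₉, t₉)` in HSUBʰ's currency, host dropped.  Conditional on (T-k) through the tail.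
[OURS · L1 W4.5b · D9 «ν3-DIRECT» helper = PHASE 2 of ✓ `hsube_of_suppliers`; counted 0; EL♮(3) NOT proved] -/
theorem noseRound_stage_of_model (hF : EmbeddedCurveLiftFact) (k : Type) [Field k] [IsAlgClosed k]
    (O : Type) [CommRing O] [IsDomain O] [IsDiscreteValuationRing O] [IsAdicComplete (IsLocalRing.maximalIdeal O) O]
    [IsAlgClosed (IsLocalRing.ResidueField O)] (θ : O →+* k) (hθ : Function.Surjective θ)
    (P : Scheme.{0}) (q : P ⟶ Spec (.of O)) (Y : Set P) (Ch : ∀ X' : Scheme.{0}, (X' ⟶ P) → Set X' → Prop)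
    (hChStep : ∀ (X' X'' : Scheme.{0}) (σ' : X' ⟶ P) (S' : Set X') (C : X'.IdealSheafData) (τ : X'' ⟶ X'),
      Ch X' σ' S' → IsBlowup τ C → Scheme.IsRegular C.subscheme → Flat (C.subschemeι ≫ σ' ≫ q) →
      σ' '' (C.support : Set X') ⊆ {y | ¬ IsGenericPoint y Y} → (C.support : Set X') ∩ (σ' ≫ q) ⁻¹' {IsLocalRing.closedPoint O} ⊆ S' →
      Ch X'' (τ ≫ σ') (closure (τ ⁻¹' (S' \ (C.support : Set X')))))
    (hChSplit : ∀ (X' : Scheme.{0}) (σ' : X' ⟶ P) (S' : Set X'), Ch X' σ' S' → Chain P Y X' σ' S')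
    (hYsp : Y ⊆ q ⁻¹' {IsLocalRing.closedPoint O}) (hYirr : IsIrreducible Y) (hYcl : IsClosed Y) (hPint : IsIntegral P)
    (hPnoeth : IsLocallyNoetherian P) (hPreg : Scheme.IsRegular P) (hqprop : IsProper q) (hqsm : SmoothOfRelativeDimension 3 q)
    -- the downstairs stage `(F₂, T₂)` and its nose curve `Z₂` (no map to `ℙ³_k` is needed)
    (F₂ : Scheme.{0}) (T₂ Z₂ : Set F₂) (hZ₂ : IsClosed Z₂) (hZ₂T : Z₂ ⊆ T₂) (hT₂Z : ¬ (T₂ ⊆ Z₂)) (hZ₂inf : Z₂.Infinite)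
    (hZ₂dim : ∀ z : ↥(redSub F₂ Z₂ hZ₂), IsClosed ({z} : Set ↥(redSub F₂ Z₂ hZ₂)) →
      ringKrullDim ((redSub F₂ Z₂ hZ₂).presheaf.stalk z) = ((1 : ℕ) : WithBot ℕ∞))
    -- its upstairs stage WITH a regular `O`-flat model `C` of `Z₂` with reduced trace (the HEND block of ✓ `hsube_of_suppliers`, verbatim)
    (hmodel : ∃ (X' : Scheme.{0}) (σ' : X' ⟶ P) (S' : Set X') (j : F₂ ⟶ X') (t : F₂ ⟶ Spec (.of k)) (C : X'.IdealSheafData),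
        Ch X' σ' S' ∧ IsIntegral X' ∧ IsLocallyNoetherian X' ∧ Scheme.IsRegular X' ∧ IsDominant (σ' ≫ q) ∧ IsIntegral F₂ ∧
        IsPullback j t (σ' ≫ q) (Spec.map (CommRingCat.ofHom θ)) ∧ IsClosed T₂ ∧ IsIrreducible T₂ ∧ j '' T₂ = S' ∧
        Scheme.IsRegular C.subscheme ∧ Flat (C.subschemeι ≫ σ' ≫ q) ∧ C.comap j = vanishingIdeal (⟨Z₂, hZ₂⟩ : Closeds F₂))
    -- the nose blow-up and the B‴ tail (door clauses verbatim; the reached downstairs stage is `(F₉, T₉)`)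
    (F₃ : Scheme.{0}) (υ' : F₃ ⟶ F₂) (hυ' : IsBlowup υ' (vanishingIdeal (⟨Z₂, hZ₂⟩ : Closeds F₂)))
    (F₉ : Scheme.{0}) (γ' : F₉ ⟶ F₃) (T₉ E' : Set F₉) (Es' Ns' : List (Set F₉)) (K' : Set F₉)
    (htail : ∀ R : (∀ G : Scheme.{0}, (G ⟶ F₃) → Set G → Set G → List (Set G) → List (Set G) → Set G → Prop),
        R F₃ (𝟙 F₃) (closure (υ' ⁻¹' (T₂ \ Z₂))) (υ' ⁻¹' Z₂) [] [] ∅ →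
        TowerPtRegB₄ F₃ R → TowerPtRamB₄ F₃ R → TowerRoundBTriplePrime F₂ F₃ υ' Z₂ hZ₂ R →
        R F₉ γ' T₉ E' Es' Ns' K') :
    ∃ (X₉ : Scheme.{0}) (σ₉ : X₉ ⟶ P) (S₉ : Set X₉) (j₉ : F₉ ⟶ X₉) (t₉ : F₉ ⟶ Spec (.of k)),
      Ch X₉ σ₉ S₉ ∧ IsIntegral X₉ ∧ IsLocallyNoetherian X₉ ∧ Scheme.IsRegular X₉ ∧ IsDominant (σ₉ ≫ q) ∧
      IsPullback j₉ t₉ (σ₉ ≫ q) (Spec.map (CommRingCat.ofHom θ)) ∧ j₉ '' T₉ = S₉ ∧ IsClosed T₉ ∧ IsIrreducible T₉ ∧ IsIntegral F₉ ∧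
      TCPlus.LetterDatum O P q Y F₉ X₉ σ₉ j₉ (∅ : Set F₉) := by
  classical
  obtain ⟨X', σ', S', j, t, C, hCh', hX'int, hX'noeth, hX'reg, hX'dom, hF₂, hsq, hT₂cl, hT₂irr, hjT₂, hCreg, hCfl, hCj⟩ := hmodel
  subst hjT₂
  haveI := hPint; haveI := hPnoeth; haveI := hX'int; haveI := hX'noeth; haveI := hF₂
  -- E1-legality of `C` upstairs: off the generic point of `Y` (from the chain and `¬ T₂ ⊆ Z₂`)
  have hoff : σ' '' (C.support : Set X') ⊆ {y : P | ¬ IsGenericPoint y Y} :=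
    image_support_subset_not_isGenericPoint_of_chain θ hθ q Y hYsp σ' (j '' T₂) (hChSplit _ _ _ hCh') j t hsq T₂ rfl C Z₂ hZ₂ hCj hT₂Z
  have hCoff : ∀ c ∈ (C.support : Set X'), ¬ IsGenericPoint (σ' c) Y := fun c hc => hoff ⟨c, hc, rfl⟩
  -- the upstairs blow-up of `C` and the model square for the nose blow-up `υ'` (`modelStep_chain`)
  have hDT : (((vanishingIdeal (⟨Z₂, hZ₂⟩ : Closeds F₂)) : F₂.IdealSheafData).support : Set F₂) ⊆ T₂ := by
    rw [Scheme.IdealSheafData.coe_support_vanishingIdeal]; exact hZ₂T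
  have hTD : ¬ T₂ ⊆ (((vanishingIdeal (⟨Z₂, hZ₂⟩ : Closeds F₂)) : F₂.IdealSheafData).support : Set F₂) := by
    rw [Scheme.IdealSheafData.coe_support_vanishingIdeal]; exact hT₂Z
  obtain ⟨X₂, τ₂, hτ₂⟩ := exists_isBlowup X' C
  obtain ⟨hX₂i, hX₂n, hX₂r, hX₂dom, hF₃i, hirr₃, j₃, t₃, hsq₃, hcomm₃, hCh₃⟩ :=
    modelStep_chain O k θ hθ P q Y hYirr hYcl Ch hChSplit hChStep X' σ' (j '' T₂) hCh' hX'reg hX'dom F₂ j t hsq T₂ rfl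
      C (vanishingIdeal (⟨Z₂, hZ₂⟩ : Closeds F₂)) hCj hCreg hCfl hoff hDT hTD X₂ τ₂ hτ₂ F₃ υ' hυ'
  rw [Scheme.IdealSheafData.coe_support_vanishingIdeal] at hirr₃ hCh₃
  have hexc₃ : (C.comap τ₂).comap j₃ = (vanishingIdeal (⟨Z₂, hZ₂⟩ : Closeds F₂)).comap υ' := by
    rw [← Scheme.IdealSheafData.comap_comp, hcomm₃, Scheme.IdealSheafData.comap_comp, hCj]
  -- the stage-generic nose engine‴ on the B‴ tail, fed with (T-k) at the base `(k, O, θ, P, q)`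
  obtain ⟨X₉, σ₉, S₉, j₉, t₉, h1, h2, h3, h4, h5, h6, h7, h8, h9, h10⟩ :=
    hsub_reachNoseTowerBTriplePrime_of_fact' k O θ hθ P q Y Ch hChStep hChSplit hYsp hYirr hYcl hPint hPnoeth hPreg hqprop hqsm
      X' σ' (j '' T₂) hCh' hX'int hX'noeth hX'reg hX'dom F₂ hF₂ j t hsq T₂ hT₂cl hT₂irr rfl
      Z₂ hZ₂ hZ₂T hT₂Z hZ₂inf hZ₂dim C hCreg hCfl hCj hCoff X₂ τ₂ hτ₂ hX₂i hX₂n hX₂r hX₂dom F₃ hF₃i υ' hυ' j₃ t₃ hsq₃ hcomm₃ hexc₃ hirr₃ hCh₃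
      (hF k O θ hθ P q) F₉ γ' T₉ E' K' ⟨Es', Ns', htail⟩
  -- the host is dropped: the empty letter has the trivial model
  exact ⟨X₉, σ₉, S₉, j₉, t₉, h1, h2, h3, h4, h5, h6, h7, h8, h9, h10, TCPlus.letterDatum_empty O P q Y F₉ X₉ σ₉ j₉⟩

/-- **The HEND block AT THE INITIAL STAGE from a given model `𝓦` of the nose.**  In the K5 engines' initial context (`ℙ³_O` over `O`, the
graded coefficient map `φ` over `θ : O → k`, the chain predicate `Ch` holding at `(ℙ³_O, 𝟙, Y)`, `Y = range (ι ≫ Proj φ)`), an ideal sheaf `𝓦` on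
`ℙ³_O` with `V(𝓦)` regular, `V(𝓦) → Spec O` flat and `𝓦.comap (Proj φ) = 𝓘⟨Z⟩` (the three conjuncts of res-L1-w45b-stub-2's `planar_trace_smoothing`)
IS the HEND block of ✓ `hsube_of_suppliers` at the stage `(ℙ³_k, range ι, Z)`: upstairs stage `(ℙ³_O, 𝟙, Y, Proj φ, t)` with the base model square
(`ProjectiveAmbientFibre.isPullback_projMap`) and dominance, as N-0 Level A ✓ `jinit_rPlus₀_of_noseDatum` discharges them.
[OURS · L1 W4.5b · D9 «ν3-DIRECT» helper; pure bookkeeping; counted 0; EL♮(3) NOT proved] -/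
theorem hendBlock_stage_zero_of_model (k : Type) [Field k] [IsAlgClosed k] (H : Scheme.{0})
    (ι : H ⟶ (Literature.AlgebraicGeometry.Motives.projectiveSpace 3 k).left)
    (hι : AlgebraicGeometry.IsClosedImmersion ι) (hH : AlgebraicGeometry.IsIntegral H)
    (O : Type) [CommRing O] [IsDomain O] [IsDiscreteValuationRing O] (θ : O →+* k) (hθ : Function.Surjective θ) :
    letI := MvPolynomial.gradedAlgebra (σ := Fin (3 + 1)) (R := O); letI := MvPolynomial.gradedAlgebra (σ := Fin (3 + 1)) (R := k);
    ∀ (φ : MvPolynomial.homogeneousSubmodule (Fin (3 + 1)) O →+*ᵍ MvPolynomial.homogeneousSubmodule (Fin (3 + 1)) k)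
      (hφ' : HomogeneousIdeal.irrelevant (MvPolynomial.homogeneousSubmodule (Fin (3 + 1)) k) ≤ (HomogeneousIdeal.irrelevant (MvPolynomial.homogeneousSubmodule (Fin (3 + 1)) O)).map φ), (∀ s, φ s = MvPolynomial.map θ s) →
    ∀ (Ch : ∀ X' : AlgebraicGeometry.Scheme.{0}, (X' ⟶ (AlgebraicGeometry.Proj (MvPolynomial.homogeneousSubmodule (Fin (3 + 1)) O))) → Set X' → Prop),
      AlgebraicGeometry.IsIntegral (AlgebraicGeometry.Proj (MvPolynomial.homogeneousSubmodule (Fin (3 + 1)) O)) → IsLocallyNoetherian (AlgebraicGeometry.Proj (MvPolynomial.homogeneousSubmodule (Fin (3 + 1)) O)) → Literature.AlgebraicGeometry.Resolution.Scheme.IsRegular (AlgebraicGeometry.Proj (MvPolynomial.homogeneousSubmodule (Fin (3 + 1)) O)) →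
      -- the INITIAL stage is in the chain
      Ch (AlgebraicGeometry.Proj (MvPolynomial.homogeneousSubmodule (Fin (3 + 1)) O)) (𝟙 (AlgebraicGeometry.Proj (MvPolynomial.homogeneousSubmodule (Fin (3 + 1)) O))) (Set.range (ι ≫ AlgebraicGeometry.Proj.map φ hφ' : H ⟶ (AlgebraicGeometry.Proj (MvPolynomial.homogeneousSubmodule (Fin (3 + 1)) O)))) →
    -- the nose `Z` and its MODEL `𝓦` (the smoothing's three conjuncts)
    ∀ (Z : Set (Literature.AlgebraicGeometry.Motives.projectiveSpace 3 k).left) (hZ : IsClosed Z)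
      (𝓦 : (AlgebraicGeometry.Proj (MvPolynomial.homogeneousSubmodule (Fin (3 + 1)) O)).IdealSheafData),
      Literature.AlgebraicGeometry.Resolution.Scheme.IsRegular 𝓦.subscheme →
      AlgebraicGeometry.Flat (𝓦.subschemeι ≫ (AlgebraicGeometry.Proj.toSpecZero (MvPolynomial.homogeneousSubmodule (Fin (3 + 1)) O) ≫ AlgebraicGeometry.Spec.map (CommRingCat.ofHom (algebraMap O (MvPolynomial.homogeneousSubmodule (Fin (3 + 1)) O 0))))) →
      𝓦.comap (AlgebraicGeometry.Proj.map φ hφ') = vanishingIdeal (⟨Z, hZ⟩ : Closeds (Literature.AlgebraicGeometry.Motives.projectiveSpace 3 k).left) →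
    ∃ (X' : Scheme.{0}) (σ' : X' ⟶ (AlgebraicGeometry.Proj (MvPolynomial.homogeneousSubmodule (Fin (3 + 1)) O))) (S' : Set X')
      (j : (Literature.AlgebraicGeometry.Motives.projectiveSpace 3 k).left ⟶ X') (t : (Literature.AlgebraicGeometry.Motives.projectiveSpace 3 k).left ⟶ Spec (.of k)) (C : X'.IdealSheafData),
      Ch X' σ' S' ∧ IsIntegral X' ∧ IsLocallyNoetherian X' ∧ Scheme.IsRegular X' ∧
      IsDominant (σ' ≫ (AlgebraicGeometry.Proj.toSpecZero (MvPolynomial.homogeneousSubmodule (Fin (3 + 1)) O) ≫ AlgebraicGeometry.Spec.map (CommRingCat.ofHom (algebraMap O (MvPolynomial.homogeneousSubmodule (Fin (3 + 1)) O 0))))) ∧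
      IsIntegral (Literature.AlgebraicGeometry.Motives.projectiveSpace 3 k).left ∧
      IsPullback j t (σ' ≫ (AlgebraicGeometry.Proj.toSpecZero (MvPolynomial.homogeneousSubmodule (Fin (3 + 1)) O) ≫ AlgebraicGeometry.Spec.map (CommRingCat.ofHom (algebraMap O (MvPolynomial.homogeneousSubmodule (Fin (3 + 1)) O 0))))) (Spec.map (CommRingCat.ofHom θ)) ∧
      IsClosed (Set.range ι) ∧ IsIrreducible (Set.range ι) ∧ j '' (Set.range ι) = S' ∧
      Scheme.IsRegular C.subscheme ∧
      Flat (C.subschemeι ≫ σ' ≫ (AlgebraicGeometry.Proj.toSpecZero (MvPolynomial.homogeneousSubmodule (Fin (3 + 1)) O) ≫ AlgebraicGeometry.Spec.map (CommRingCat.ofHom (algebraMap O (MvPolynomial.homogeneousSubmodule (Fin (3 + 1)) O 0))))) ∧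
      C.comap j = vanishingIdeal (⟨Z, hZ⟩ : Closeds (Literature.AlgebraicGeometry.Motives.projectiveSpace 3 k).left) := by
  classical
  letI := MvPolynomial.gradedAlgebra (σ := Fin (3 + 1)) (R := O)
  letI := MvPolynomial.gradedAlgebra (σ := Fin (3 + 1)) (R := k)
  intro φ hφ' hφ Ch hPint hPnoeth hPreg hCh₀ Z hZ 𝓦 h𝓦reg h𝓦fl h𝓦tr
  set q : Proj (homogeneousSubmodule (Fin (3 + 1)) O) ⟶ Spec (.of O) :=
    Proj.toSpecZero (homogeneousSubmodule (Fin (3 + 1)) O) ≫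
      Spec.map (CommRingCat.ofHom (algebraMap O (homogeneousSubmodule (Fin (3 + 1)) O 0))) with hq
  set g : Proj (homogeneousSubmodule (Fin (3 + 1)) k) ⟶ Proj (homogeneousSubmodule (Fin (3 + 1)) O) := Proj.map φ hφ' with hg
  haveI := hι
  haveI := hH
  -- the base model square (K5ᵉ engine / N-0 Level A verbatim)
  have hP := ProjectiveAmbientFibre.isPullback_projMap θ φ hφ hθ hφ'
  have hsq₀ : IsPullback g (Proj.toSpecZero (homogeneousSubmodule (Fin (3 + 1)) k) ≫
      Spec.map (CommRingCat.ofHom (algebraMap k (homogeneousSubmodule (Fin (3 + 1)) k 0))))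
      (𝟙 _ ≫ q) (Spec.map (CommRingCat.ofHom θ)) := by
    rw [Category.id_comp]; exact hP
  -- dominance of the initial stage
  obtain ⟨hsm, -⟩ := stub_projectiveAmbientSmoothProper O 3
  haveI : Nonempty H := inferInstance
  haveI : Nonempty (Proj (homogeneousSubmodule (Fin (3 + 1)) O)) := ⟨g (ι (Classical.arbitrary H))⟩
  haveI : Smooth q := hsm
  haveI : IsDominant q := isDominant_of_smooth_of_nonempty q
  have hdom₀ : IsDominant (𝟙 (Proj (homogeneousSubmodule (Fin (3 + 1)) O)) ≫ q) := by
    rw [Category.id_comp]; infer_instance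
  have hirrι : IsIrreducible (Set.range ι) := by
    have h := (IrreducibleSpace.isIrreducible_univ H).image ι ι.continuous.continuousOn
    rwa [Set.image_univ] at h
  have hfl' : Flat (𝓦.subschemeι ≫ 𝟙 (Proj (homogeneousSubmodule (Fin (3 + 1)) O)) ≫ q) := by
    rw [Category.id_comp]; exact h𝓦fl
  refine ⟨_, 𝟙 _, _, g, _, 𝓦, hCh₀, hPint, hPnoeth, hPreg, hdom₀, isIntegral_proj_homogeneousSubmodule 3 k, hsq₀,
    ι.isClosedEmbedding.isClosed_range, hirrι, ?_, h𝓦reg, hfl', h𝓦tr⟩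
  change g '' Set.range ι = Set.range (ι ≫ g)
  rw [← Set.range_comp]
  rfl

/-- **ONE DIRECT PLANAR NOSE MOVE AT THE INITIAL STAGE, UPSTAIRS — modulo the door unpacking and the smoothing.**  In the K5 engines' initial
context, for a nose `Z ⊆ range ι` (infinite, `range ι ⊄ Z`, curve clause) with a MODEL `𝓦` on `ℙ³_O` (`V(𝓦)` regular, `O`-flat, reduced trace
`𝓦.comap (Proj φ) = 𝓘⟨Z⟩` — res-L1-w45b-stub-2's `planar_trace_smoothing`), the nose blow-up `υ' : F₃ ⟶ ℙ³_k` of `𝓘⟨Z⟩` followed by a B‴ tail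
(door clause verbatim, `(F₂, T₂, Z₂, υ) := (ℙ³_k, range ι, Z, 𝟙)`) is matched by a new upstairs stage in HSUBʰ's currency with the host dropped —
`hendBlock_stage_zero_of_model` then `noseRound_stage_of_model`.  This is ✓ `hsube_of_suppliers` with PHASE 1 deleted and HEND := the given model
(NU7-NOSE-SIZING v1.2 §A2 «HSUB-direct»), door-text-free.  Conditional on (T-k) through the tail.
[OURS · L1 W4.5b · D9 «ν3-DIRECT» helper; counted 0; EL♮(3) NOT proved] -/
theorem directNose_stage_zero_of_model (hF : EmbeddedCurveLiftFact) (k : Type) [Field k] [IsAlgClosed k] (H : Scheme.{0})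
    (ι : H ⟶ (Literature.AlgebraicGeometry.Motives.projectiveSpace 3 k).left)
    (hι : AlgebraicGeometry.IsClosedImmersion ι) (hH : AlgebraicGeometry.IsIntegral H)
    (O : Type) [CommRing O] [IsDomain O] [IsDiscreteValuationRing O] [IsAdicComplete (IsLocalRing.maximalIdeal O) O]
    [IsAlgClosed (IsLocalRing.ResidueField O)] (θ : O →+* k) (hθ : Function.Surjective θ) :
    letI := MvPolynomial.gradedAlgebra (σ := Fin (3 + 1)) (R := O); letI := MvPolynomial.gradedAlgebra (σ := Fin (3 + 1)) (R := k);
    ∀ (φ : MvPolynomial.homogeneousSubmodule (Fin (3 + 1)) O →+*ᵍ MvPolynomial.homogeneousSubmodule (Fin (3 + 1)) k)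
      (hφ' : HomogeneousIdeal.irrelevant (MvPolynomial.homogeneousSubmodule (Fin (3 + 1)) k) ≤ (HomogeneousIdeal.irrelevant (MvPolynomial.homogeneousSubmodule (Fin (3 + 1)) O)).map φ), (∀ s, φ s = MvPolynomial.map θ s) →
    ∀ (Ch : ∀ X' : AlgebraicGeometry.Scheme.{0}, (X' ⟶ (AlgebraicGeometry.Proj (MvPolynomial.homogeneousSubmodule (Fin (3 + 1)) O))) → Set X' → Prop),
      (∀ (X' X'' : AlgebraicGeometry.Scheme.{0}) (σ' : X' ⟶ (AlgebraicGeometry.Proj (MvPolynomial.homogeneousSubmodule (Fin (3 + 1)) O))) (S' : Set X') (C : X'.IdealSheafData) (τ : X'' ⟶ X'), Ch X' σ' S' → Literature.AlgebraicGeometry.Resolution.IsBlowup τ C →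
        Literature.AlgebraicGeometry.Resolution.Scheme.IsRegular C.subscheme → AlgebraicGeometry.Flat (C.subschemeι ≫ σ' ≫ (AlgebraicGeometry.Proj.toSpecZero (MvPolynomial.homogeneousSubmodule (Fin (3 + 1)) O) ≫ AlgebraicGeometry.Spec.map (CommRingCat.ofHom (algebraMap O (MvPolynomial.homogeneousSubmodule (Fin (3 + 1)) O 0))))) → σ' '' (C.support : Set X') ⊆ {y | ¬ IsGenericPoint y (Set.range (ι ≫ AlgebraicGeometry.Proj.map φ hφ' : H ⟶ (AlgebraicGeometry.Proj (MvPolynomial.homogeneousSubmodule (Fin (3 + 1)) O))))} →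
        (C.support : Set X') ∩ (σ' ≫ (AlgebraicGeometry.Proj.toSpecZero (MvPolynomial.homogeneousSubmodule (Fin (3 + 1)) O) ≫ AlgebraicGeometry.Spec.map (CommRingCat.ofHom (algebraMap O (MvPolynomial.homogeneousSubmodule (Fin (3 + 1)) O 0))))) ⁻¹' {IsLocalRing.closedPoint O} ⊆ S' → Ch X'' (τ ≫ σ') (closure (τ ⁻¹' (S' \ (C.support : Set X'))))) → (∀ (X' : AlgebraicGeometry.Scheme.{0}) (σ' : X' ⟶ (AlgebraicGeometry.Proj (MvPolynomial.homogeneousSubmodule (Fin (3 + 1)) O))) (S' : Set X'), Ch X' σ' S' →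
        Summit.ResolutionOfSingularities.ResolutionOfSingularities.Theses.EquisingularLift.Split.Chain (AlgebraicGeometry.Proj (MvPolynomial.homogeneousSubmodule (Fin (3 + 1)) O)) (Set.range (ι ≫ AlgebraicGeometry.Proj.map φ hφ' : H ⟶ (AlgebraicGeometry.Proj (MvPolynomial.homogeneousSubmodule (Fin (3 + 1)) O)))) X' σ' S') → (Set.range (ι ≫ AlgebraicGeometry.Proj.map φ hφ' : H ⟶ (AlgebraicGeometry.Proj (MvPolynomial.homogeneousSubmodule (Fin (3 + 1)) O)))) ⊆ (AlgebraicGeometry.Proj.toSpecZero (MvPolynomial.homogeneousSubmodule (Fin (3 + 1)) O) ≫ AlgebraicGeometry.Spec.map (CommRingCat.ofHom (algebraMap O (MvPolynomial.homogeneousSubmodule (Fin (3 + 1)) O 0)))) ⁻¹' {IsLocalRing.closedPoint O} → IsIrreducible (Set.range (ι ≫ AlgebraicGeometry.Proj.map φ hφ' : H ⟶ (AlgebraicGeometry.Proj (MvPolynomial.homogeneousSubmodule (Fin (3 + 1)) O)))) → IsClosed (Set.range (ι ≫ AlgebraicGeometry.Proj.map φ hφ' : H ⟶ (AlgebraicGeometry.Proj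 (MvPolynomial.homogeneousSubmodule (Fin (3 + 1)) O)))) →
      AlgebraicGeometry.IsIntegral (AlgebraicGeometry.Proj (MvPolynomial.homogeneousSubmodule (Fin (3 + 1)) O)) → IsLocallyNoetherian (AlgebraicGeometry.Proj (MvPolynomial.homogeneousSubmodule (Fin (3 + 1)) O)) → Literature.AlgebraicGeometry.Resolution.Scheme.IsRegular (AlgebraicGeometry.Proj (MvPolynomial.homogeneousSubmodule (Fin (3 + 1)) O)) → AlgebraicGeometry.IsProper (AlgebraicGeometry.Proj.toSpecZero (MvPolynomial.homogeneousSubmodule (Fin (3 + 1)) O) ≫ AlgebraicGeometry.Spec.map (CommRingCat.ofHom (algebraMap O (MvPolynomial.homogeneousSubmodule (Fin (3 + 1)) O 0)))) → AlgebraicGeometry.SmoothOfRelativeDimension 3 (AlgebraicGeometry.Proj.toSpecZero (MvPolynomial.homogeneousSubmodule (Fin (3 + 1)) O) ≫ AlgebraicGeometry.Spec.map (CommRingCat.ofHom (algebraMap O (MvPolynomial.homogeneousSubmodule (Fin (3 + 1)) O 0)))) →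
      -- the INITIAL stage is in the chain
      Ch (AlgebraicGeometry.Proj (MvPolynomial.homogeneousSubmodule (Fin (3 + 1)) O)) (𝟙 (AlgebraicGeometry.Proj (MvPolynomial.homogeneousSubmodule (Fin (3 + 1)) O))) (Set.range (ι ≫ AlgebraicGeometry.Proj.map φ hφ' : H ⟶ (AlgebraicGeometry.Proj (MvPolynomial.homogeneousSubmodule (Fin (3 + 1)) O)))) →
    -- the nose `Z ⊆ range ι` (door clauses: in the surface, not all of it, infinite, curve clause) and its MODEL `𝓦`
    ∀ (Z : Set (Literature.AlgebraicGeometry.Motives.projectiveSpace 3 k).left) (hZ : IsClosed Z),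
      Z ⊆ Set.range ι → ¬ (Set.range ι ⊆ Z) → Z.Infinite →
      (∀ z : ↥(redSub (Literature.AlgebraicGeometry.Motives.projectiveSpace 3 k).left Z hZ), IsClosed ({z} : Set ↥(redSub (Literature.AlgebraicGeometry.Motives.projectiveSpace 3 k).left Z hZ)) →
        ringKrullDim ((redSub (Literature.AlgebraicGeometry.Motives.projectiveSpace 3 k).left Z hZ).presheaf.stalk z) = ((1 : ℕ) : WithBot ℕ∞)) →
    ∀ (𝓦 : (AlgebraicGeometry.Proj (MvPolynomial.homogeneousSubmodule (Fin (3 + 1)) O)).IdealSheafData),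
      Literature.AlgebraicGeometry.Resolution.Scheme.IsRegular 𝓦.subscheme →
      AlgebraicGeometry.Flat (𝓦.subschemeι ≫ (AlgebraicGeometry.Proj.toSpecZero (MvPolynomial.homogeneousSubmodule (Fin (3 + 1)) O) ≫ AlgebraicGeometry.Spec.map (CommRingCat.ofHom (algebraMap O (MvPolynomial.homogeneousSubmodule (Fin (3 + 1)) O 0))))) →
      𝓦.comap (AlgebraicGeometry.Proj.map φ hφ') = vanishingIdeal (⟨Z, hZ⟩ : Closeds (Literature.AlgebraicGeometry.Motives.projectiveSpace 3 k).left) →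
    -- THE MOVE: the nose blow-up at the initial stage and the B‴ tail (door clauses verbatim, `(F₂, T₂, Z₂) := (ℙ³_k, range ι, Z)`)
    ∀ (F₃ : Scheme.{0}) (υ' : F₃ ⟶ (Literature.AlgebraicGeometry.Motives.projectiveSpace 3 k).left),
      IsBlowup υ' (vanishingIdeal (⟨Z, hZ⟩ : Closeds (Literature.AlgebraicGeometry.Motives.projectiveSpace 3 k).left)) →
    ∀ (F₉ : Scheme.{0}) (γ' : F₉ ⟶ F₃) (T₉ E' : Set F₉) (Es' Ns' : List (Set F₉)) (K' : Set F₉),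
      (∀ R : (∀ G : Scheme.{0}, (G ⟶ F₃) → Set G → Set G → List (Set G) → List (Set G) → Set G → Prop),
        R F₃ (𝟙 F₃) (closure (υ' ⁻¹' (Set.range ι \ Z))) (υ' ⁻¹' Z) [] [] ∅ →
        TowerPtRegB₄ F₃ R → TowerPtRamB₄ F₃ R → TowerRoundBTriplePrime (Literature.AlgebraicGeometry.Motives.projectiveSpace 3 k).left F₃ υ' Z hZ R →
        R F₉ γ' T₉ E' Es' Ns' K') →
    ∃ (X₉ : Scheme.{0}) (σ₉ : X₉ ⟶ (AlgebraicGeometry.Proj (MvPolynomial.homogeneousSubmodule (Fin (3 + 1)) O))) (S₉ : Set X₉) (j₉ : F₉ ⟶ X₉) (t₉ : F₉ ⟶ AlgebraicGeometry.Spec (.of k)),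
      Ch X₉ σ₉ S₉ ∧ AlgebraicGeometry.IsIntegral X₉ ∧ IsLocallyNoetherian X₉ ∧ Literature.AlgebraicGeometry.Resolution.Scheme.IsRegular X₉ ∧ AlgebraicGeometry.IsDominant (σ₉ ≫ (AlgebraicGeometry.Proj.toSpecZero (MvPolynomial.homogeneousSubmodule (Fin (3 + 1)) O) ≫ AlgebraicGeometry.Spec.map (CommRingCat.ofHom (algebraMap O (MvPolynomial.homogeneousSubmodule (Fin (3 + 1)) O 0))))) ∧
      IsPullback j₉ t₉ (σ₉ ≫ (AlgebraicGeometry.Proj.toSpecZero (MvPolynomial.homogeneousSubmodule (Fin (3 + 1)) O) ≫ AlgebraicGeometry.Spec.map (CommRingCat.ofHom (algebraMap O (MvPolynomial.homogeneousSubmodule (Fin (3 + 1)) O 0))))) (AlgebraicGeometry.Spec.map (CommRingCat.ofHom θ)) ∧ j₉ '' T₉ = S₉ ∧ IsClosed T₉ ∧ IsIrreducible T₉ ∧ AlgebraicGeometry.IsIntegral F₉ ∧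
      TCPlus.LetterDatum O (AlgebraicGeometry.Proj (MvPolynomial.homogeneousSubmodule (Fin (3 + 1)) O)) (AlgebraicGeometry.Proj.toSpecZero (MvPolynomial.homogeneousSubmodule (Fin (3 + 1)) O) ≫ AlgebraicGeometry.Spec.map (CommRingCat.ofHom (algebraMap O (MvPolynomial.homogeneousSubmodule (Fin (3 + 1)) O 0)))) (Set.range (ι ≫ AlgebraicGeometry.Proj.map φ hφ' : H ⟶ (AlgebraicGeometry.Proj (MvPolynomial.homogeneousSubmodule (Fin (3 + 1)) O)))) F₉ X₉ σ₉ j₉ (∅ : Set F₉) := by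
  classical
  letI := MvPolynomial.gradedAlgebra (σ := Fin (3 + 1)) (R := O)
  letI := MvPolynomial.gradedAlgebra (σ := Fin (3 + 1)) (R := k)
  intro φ hφ' hφ Ch hChStep hChSplit hYsp hYirr hYcl hPint hPnoeth hPreg hqprop hqsm hCh₀ Z hZ hZT hTZ hZinf hZdim 𝓦 h𝓦reg h𝓦fl h𝓦tr
    F₃ υ' hυ' F₉ γ' T₉ E' Es' Ns' K' htail
  -- the HEND block at the initial stage from the model `𝓦` …
  have hmodel := hendBlock_stage_zero_of_model k H ι hι hH O θ hθ φ hφ' hφ Ch hPint hPnoeth hPreg hCh₀ Z hZ 𝓦 h𝓦reg h𝓦fl h𝓦tr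
  -- … then PHASE 2 on it
  exact noseRound_stage_of_model hF k O θ hθ _ _ _ Ch hChStep hChSplit hYsp hYirr hYcl hPint hPnoeth hPreg hqprop hqsm
    (Literature.AlgebraicGeometry.Motives.projectiveSpace 3 k).left (Set.range ι) Z hZ hZT hTZ hZinf hZdim hmodel F₃ υ' hυ' F₉ γ' T₉ E' Es' Ns' K' htail

end Summit.ResolutionOfSingularities.ResolutionOfSingularities.Cruxes.EquisingularLiftNat.Sections.Equinodal

end
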